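import Mathlib
import Summits.NavierStokesRegularity.NavierStokesRegularity.Theorems.FilamentSkeletonRssClause13TransportAveragingVar

/-!
# Clause 13-J/13-R, brick m3b-W (POINTWISE TRANSPORT, AMPLIFIED ZONE INTEGRATED OUTWARD WITH A POLYNOMIAL WEIGHT)

Route `FilamentSkeletonRss`, ∃-side clause 13 (`Clause13RNearStraightL`, stmt-NavierStokesRegularity-23612; typing-agnostic).  Design of record
rev 80, tenure note R-m3b-2: "outward integration gives `|Y(τ)| ≤ C(β, w′)·sup|F|·(1+|τ−c|)^{b_*}` with `b_*` of the order of
`(sup(Re β₁)₊ + sup|β₂|)/inf_τ (w/(τ−c))` — linear in the defect, Γ-free, at the price `b ≥ b_*`: this IS the far-branch amplification".  The landed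
fences bound `‖Y‖` by a CONSTANT (`M/β₀`) and therefore need DAMPING (`…TransportFence`, `…TransportAveraging(Var)`, `…WaistFence`); in the
amplified zone one integrates outward against the growth by conjugating with the weight `ρ^{−p}`, `ρ = (τ−c)/(a−c) ≥ 1`:
* §1 `transport_norm_le_weighted` (real inner-product version) — `w•Y′ = BY + F` on `[a, b]`, `c < a`, `w τ ≥ w₁(τ−c)` (`w₁ > 0`),
  `⟪B τ y, y⟫ ≤ α₊‖y‖²`, `‖F‖ ≤ M`, `‖Y a‖ ≤ M/β₀`; then for `p = (α₊ + β₀)/w₁ ≥ 0`:  `‖Y τ‖ ≤ ((τ−c)/(a−c))^p · M/β₀` on `[a, b]`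
  (`V = ρ^{−p}Y` solves `w•V′ = (B − p w/(τ−c))V + ρ^{−p}F`, damped by `β₀`; apply `transport_norm_le_of_damped`);
* §2 ★ `farBranch_norm_le_weighted` (lab frame with the own-core rotation and J-averaging) — `w·z′ = iG z + α z + β z̄ + f` on `[a, b]`, `c < a`,
  `w ≥ w₁(τ−c)`, `w` continuous, `‖f‖ ≤ M`, `‖β‖ ≤ G`, `‖z a‖ ≤ M/β₀`; then for `p·w₁ = Re α + β₀ + (k/(1−k))(2|Im α| + k‖β‖)` (`k = ‖β‖/(2G)`,
  `p ≥ 0`):  `‖z τ‖ ≤ ((τ−c)/(a−c))^p · ((1+k)M/β₀)/(1−k)` on `[a, b]` (rotating frame `θ = ∫_a G/w`, then `farBranch_norm_le_of_damped_var` for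
  `v = ρ^{−p}e^{−iθ}z` with the variable rate `α − p w/(τ−c)`).
Together with `waist_norm_le_of_damped` (p713320) this is the whole outward chain waist → damped zone → amplified zone of R-m3b-2, pointwise,
linear in `M`, with the growth booked as the weight exponent `p` (= the clause's `b`).
Lane ns-filament-19175-p1 g17; `--supports stmt-NavierStokesRegularity-23612 --as helper`.
HONEST FRAMING: ODE lemmas for the bookkeeping of a HYPOTHETICAL filament skeleton on the NEGATIVE side of a MODEL route; nothing here bears on
Navier–Stokes regularity or blow-up.
-/

noncomputable section

open scoped InnerProductSpace ComplexConjugate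
open Set Complex MeasureTheory Filter Topology

namespace Summit.NavierStokesRegularity.NavierStokesRegularity.Theorems.Clause13Transport
set_option linter.dupNamespace false

variable {E : Type*} [NormedAddCommGroup E] [InnerProductSpace ℝ E]

/-! ## §0 The weight `ρ^{−p}` -/

/-- The weight `W(τ) = ((τ−c)/(a−c))^{−p}` on `τ > c` (`a > c`): positive, `≤ 1` for `τ ≥ a` when `p ≥ 0`, and
`W′(τ) = −(p/(τ−c))·W(τ)`. [folklore] -/
theorem weight_facts {a c p τ : ℝ} (hca : c < a) (hp : 0 ≤ p) (haτ : a ≤ τ) :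
    0 < ((τ - c) / (a - c)) ^ (-p) ∧ ((τ - c) / (a - c)) ^ (-p) ≤ 1 ∧
      HasDerivAt (fun r : ℝ => ((r - c) / (a - c)) ^ (-p)) (-(p / (τ - c)) * ((τ - c) / (a - c)) ^ (-p)) τ := by
  have hac : 0 < a - c := by linarith
  have hτc : 0 < τ - c := by linarith
  have hρ : 0 < (τ - c) / (a - c) := by positivity
  have hρ1 : 1 ≤ (τ - c) / (a - c) := by rw [le_div_iff₀ hac]; linarith
  refine ⟨Real.rpow_pos_of_pos hρ _, Real.rpow_le_one_of_one_le_of_nonpos hρ1 (by linarith), ?_⟩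
  have h1 : HasDerivAt (fun r : ℝ => (r - c) / (a - c)) (1 / (a - c)) τ := by
    simpa using ((hasDerivAt_id τ).sub_const c).div_const (a - c)
  have h2 := h1.rpow_const (p := -p) (Or.inl hρ.ne')
  have e : 1 / (a - c) * (-p) * ((τ - c) / (a - c)) ^ (-p - 1) = -(p / (τ - c)) * ((τ - c) / (a - c)) ^ (-p) := by
    rw [show (-p - 1 : ℝ) = -p + (-1) by ring, Real.rpow_add hρ, Real.rpow_neg_one]
    field_simp
  rw [e] at h2
  exact h2

/-! ## §1 Real inner-product version -/

/-- **Weighted outward transport (real version).**  `w•Y′ = BY + F` on `[a, b]` with `c < a`, `w τ ≥ w₁(τ−c)` (`w₁ > 0`),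
`⟪B τ y, y⟫ ≤ α₊‖y‖²`, `‖F τ‖ ≤ M`, `‖Y a‖ ≤ M/β₀` (`β₀ > 0`, `α₊ + β₀ ≥ 0`).  Then with `p = (α₊ + β₀)/w₁`:
`‖Y τ‖ ≤ ((τ−c)/(a−c))^p · M/β₀` on `[a, b]`. [folklore] -/
theorem transport_norm_le_weighted {Y Y' F : ℝ → E} {B : ℝ → E →L[ℝ] E} {w : ℝ → ℝ} {a b c M β₀ w₁ αp p : ℝ}
    (hβ₀ : 0 < β₀) (hM : 0 ≤ M) (hca : c < a) (hw₁ : 0 < w₁) (hp : p = (αp + β₀) / w₁) (hp0 : 0 ≤ αp + β₀)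
    (hderiv : ∀ τ ∈ Icc a b, HasDerivAt Y (Y' τ) τ) (hode : ∀ τ ∈ Icc a b, w τ • Y' τ = B τ (Y τ) + F τ)
    (hw : ∀ τ ∈ Icc a b, w₁ * (τ - c) ≤ w τ) (hB : ∀ τ ∈ Icc a b, ∀ y : E, ⟪B τ y, y⟫_ℝ ≤ αp * ‖y‖ ^ 2)
    (hF : ∀ τ ∈ Icc a b, ‖F τ‖ ≤ M) (ha : ‖Y a‖ ≤ M / β₀) :
    ∀ τ ∈ Icc a b, ‖Y τ‖ ≤ ((τ - c) / (a - c)) ^ p * (M / β₀) := by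
  have hpnn : 0 ≤ p := by rw [hp]; positivity
  have hac : 0 < a - c := by linarith
  -- the conjugated unknown `V = ρ^{-p} • Y`
  set W : ℝ → ℝ := fun r => ((r - c) / (a - c)) ^ (-p) with hW
  set V : ℝ → E := fun r => W r • Y r with hV
  set V' : ℝ → E := fun r => W r • Y' r + (-(p / (r - c)) * W r) • Y r with hV'
  set Bt : ℝ → E →L[ℝ] E := fun r => B r - (p * w r / (r - c)) • ContinuousLinearMap.id ℝ E with hBt
  set Ft : ℝ → E := fun r => W r • F r with hFt
  have hBt_apply : ∀ r (y : E), Bt r y = B r y - (p * w r / (r - c)) • y := fun r y => by simp [hBt]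
  have hWf : ∀ τ ∈ Icc a b, 0 < W τ ∧ W τ ≤ 1 ∧ HasDerivAt W (-(p / (τ - c)) * W τ) τ :=
    fun τ hτ => weight_facts hca hpnn hτ.1
  have hVder : ∀ τ ∈ Icc a b, HasDerivAt V (V' τ) τ := fun τ hτ => ((hWf τ hτ).2.2).smul (hderiv τ hτ)
  have hwpos : ∀ τ ∈ Icc a b, 0 < w τ := fun τ hτ => lt_of_lt_of_le (by nlinarith [hτ.1]) (hw τ hτ)
  have hodeV : ∀ τ ∈ Icc a b, w τ • V' τ = Bt τ (V τ) + Ft τ := by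
    intro τ hτ
    have h := hode τ hτ
    rw [hBt_apply]
    simp only [hV', hV, hFt, map_smul, smul_add, smul_smul]
    rw [show (w τ * W τ) • Y' τ = W τ • (w τ • Y' τ) by rw [smul_smul, mul_comm], h, smul_add]
    have e1 : w τ * (-(p / (τ - c)) * W τ) = -((p * w τ / (τ - c)) * W τ) := by ring
    rw [e1, neg_smul, sub_eq_add_neg]
    abel
  have hBtneg : ∀ τ ∈ Icc a b, ∀ y : E, ⟪Bt τ y, y⟫_ℝ ≤ -(β₀ * ‖y‖ ^ 2) := by
    intro τ hτ y
    have hτc : 0 < τ - c := by linarith [hτ.1]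
    rw [hBt_apply, inner_sub_left, real_inner_smul_left, real_inner_self_eq_norm_sq]
    have h1 := hB τ hτ y
    have h2 : p * w₁ = αp + β₀ := by rw [hp]; field_simp
    have h3 : p * w₁ ≤ p * w τ / (τ - c) := by
      rw [le_div_iff₀ hτc]; nlinarith [hw τ hτ, hpnn]
    nlinarith [norm_nonneg y, sq_nonneg ‖y‖]
  have hFt' : ∀ τ ∈ Icc a b, ‖Ft τ‖ ≤ M := by
    intro τ hτ
    simp only [hFt]; rw [norm_smul, Real.norm_eq_abs, abs_of_pos (hWf τ hτ).1]
    calc W τ * ‖F τ‖ ≤ 1 * M := mul_le_mul (hWf τ hτ).2.1 (hF τ hτ) (norm_nonneg _) zero_le_one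
      _ = M := one_mul M
  intro τ hτ
  have hWa : W a = 1 := by simp only [hW]; rw [div_self hac.ne', Real.one_rpow]
  have hVa : ‖V a‖ ≤ M / β₀ := by simp only [hV]; rw [hWa, one_smul]; exact ha
  have hfence := transport_norm_le_of_damped hβ₀ hM hVder hodeV hwpos hBtneg hFt' hVa τ hτ
  -- undo the weight
  have hWτ := (hWf τ hτ).1
  have hρpos : 0 < (τ - c) / (a - c) := div_pos (by linarith [hτ.1]) hac
  have hY : ‖Y τ‖ = ((τ - c) / (a - c)) ^ p * ‖V τ‖ := by
    simp only [hV]; rw [norm_smul, Real.norm_eq_abs, abs_of_pos hWτ, ← mul_assoc, hW]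
    rw [← Real.rpow_add hρpos, add_neg_cancel, Real.rpow_zero, one_mul]
  rw [hY]
  exact mul_le_mul_of_nonneg_left hfence (Real.rpow_nonneg hρpos.le _)

/-! ## §2 Lab frame with the own-core rotation and J-averaging -/

/-- ★ **WEIGHTED OUTWARD TRANSPORT IN THE AMPLIFIED ZONE (lab frame, rotation + J-averaging).**  Let `w·z′ = iG z + α z + β z̄ + f` on `[a, b]`
(`z ∈ C¹`), `c < a`, `w` continuous with `w τ ≥ w₁(τ−c)` (`w₁ > 0`), `‖f‖ ≤ M`, `‖β‖ ≤ G`, `‖z a‖ ≤ M/β₀`, and let `p ≥ 0` with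
`p·w₁ = Re α + β₀ + (k/(1−k))(2|Im α| + k‖β‖)`, `k = ‖β‖/(2G)`.  Then `‖z τ‖ ≤ ((τ−c)/(a−c))^p·((1+k)M/β₀)/(1−k)` on `[a, b]`: the J-averaged
growth rate `Re α + averaging error` is converted into the polynomial weight, and what is left is damped by `β₀`. [folklore] -/
theorem farBranch_norm_le_weighted {z z' f : ℝ → ℂ} {w : ℝ → ℝ} {a b c G M β₀ w₁ p : ℝ} {α β : ℂ}
    (hG : 0 < G) (hM : 0 ≤ M) (hβ₀ : 0 < β₀) (hca : c < a) (hw₁ : 0 < w₁)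
    (hp : p * w₁ = α.re + β₀ + (‖β‖ / (2 * G)) / (1 - ‖β‖ / (2 * G)) * (2 * |α.im| + ‖β‖ / (2 * G) * ‖β‖)) (hp0 : 0 ≤ p)
    (hz : ∀ τ ∈ Icc a b, HasDerivAt z (z' τ) τ) (hwcont : Continuous w) (hw : ∀ τ ∈ Icc a b, w₁ * (τ - c) ≤ w τ)
    (hode : ∀ τ ∈ Icc a b, (w τ : ℂ) * z' τ = I * G * z τ + α * z τ + β * conj (z τ) + f τ)
    (hf : ∀ τ ∈ Icc a b, ‖f τ‖ ≤ M) (hsmall : ‖β‖ ≤ G) (ha : ‖z a‖ ≤ M / β₀) :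
    ∀ τ ∈ Icc a b, ‖z τ‖ ≤ ((τ - c) / (a - c)) ^ p * (((1 + ‖β‖ / (2 * G)) * M / β₀) / (1 - ‖β‖ / (2 * G))) := by
  have hac : 0 < a - c := by linarith
  have hwpos : ∀ t ∈ Icc a b, 0 < w t := fun t ht => lt_of_lt_of_le (by nlinarith [ht.1]) (hw t ht)
  -- the phase `θ = ∫_a G/w` on `[a, b]`
  have hUopen : IsOpen {s : ℝ | 0 < w s} := isOpen_lt continuous_const hwcont
  have hcontU : ContinuousOn (fun s => G / w s) {s : ℝ | 0 < w s} :=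
    continuousOn_const.div hwcont.continuousOn fun s hs => ne_of_gt hs
  set θ : ℝ → ℝ := fun r => ∫ s in a..r, G / w s with hθdef
  have hθ : ∀ t ∈ Icc a b, HasDerivAt θ (G / w t) t := by
    intro t ht
    have htU : t ∈ {s : ℝ | 0 < w s} := hwpos t ht
    refine intervalIntegral.integral_hasDerivAt_right ?_ (hcontU.stronglyMeasurableAtFilter hUopen t htU)
      (hcontU.continuousAt (hUopen.mem_nhds htU))
    refine ContinuousOn.intervalIntegrable (hcontU.mono fun s hs => ?_)
    rw [uIcc_of_le ht.1] at hs
    exact hwpos s ⟨hs.1, hs.2.trans ht.2⟩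
  have hwθ : ∀ t ∈ Icc a b, w t * (G / w t) = G := fun t ht => mul_div_cancel₀ G (hwpos t ht).ne'
  -- the rotating frame `u = e^{-iθ} z`
  set u : ℝ → ℂ := fun r => cexp (-I * (θ r : ℂ)) * z r with hudef
  set u' : ℝ → ℂ := fun t => cexp (-I * (θ t : ℂ)) * (-I * ((G / w t : ℝ) : ℂ)) * z t + cexp (-I * (θ t : ℂ)) * z' t with hu'def
  have hrot : ∀ t ∈ Icc a b, HasDerivAt u (u' t) t ∧
      (w t : ℂ) * u' t = α * u t + β * cexp (-2 * I * (θ t : ℂ)) * conj (u t) + cexp (-I * (θ t : ℂ)) * f t :=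
    fun t ht => rotatingFrame (hz t ht) (hθ t ht) (hwθ t ht) (hode t ht)
  have hph : ∀ r : ℝ, ‖cexp (-I * (r : ℂ))‖ = 1 := fun r => by rw [Complex.norm_exp]; simp
  -- the weight and the conjugated unknown `v = ρ^{-p} u`
  set W : ℝ → ℝ := fun r => ((r - c) / (a - c)) ^ (-p) with hW
  have hWf : ∀ t ∈ Icc a b, 0 < W t ∧ W t ≤ 1 ∧ HasDerivAt W (-(p / (t - c)) * W t) t :=
    fun t ht => weight_facts hca hp0 ht.1
  set v : ℝ → ℂ := fun r => (W r : ℂ) * u r with hvdef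
  set v' : ℝ → ℂ := fun t => ((-(p / (t - c)) * W t : ℝ) : ℂ) * u t + (W t : ℂ) * u' t with hv'def
  have hvder : ∀ t ∈ Icc a b, HasDerivAt v (v' t) t :=
    fun t ht => ((hWf t ht).2.2.ofReal_comp).mul ((hrot t ht).1)
  set αv : ℝ → ℂ := fun t => α - ((p * w t / (t - c) : ℝ) : ℂ) with hαv
  set g : ℝ → ℂ := fun t => (W t : ℂ) * (cexp (-I * (θ t : ℂ)) * f t) with hgdef
  have hodev : ∀ t ∈ Icc a b, (w t : ℂ) * v' t = αv t * v t + β * cexp (-2 * I * (θ t : ℂ)) * conj (v t) + g t := by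
    intro t ht
    have htc : (t - c) ≠ 0 := by have := ht.1; linarith
    have h := (hrot t ht).2
    simp only [hv'def, hvdef, hαv, hgdef, map_mul, Complex.conj_ofReal]
    have e1 : (w t : ℂ) * ((((-(p / (t - c)) * W t : ℝ) : ℂ)) * u t + (W t : ℂ) * u' t)
        = (W t : ℂ) * ((w t : ℂ) * u' t) - ((p * w t / (t - c) : ℝ) : ℂ) * ((W t : ℂ) * u t) := by
      push_cast
      field_simp
      ring
    rw [e1, h]
    ring
  have hg : ∀ t ∈ Icc a b, ‖g t‖ ≤ M := by
    intro t ht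
    simp only [hgdef]
    rw [norm_mul, norm_mul, hph, one_mul, Complex.norm_real, Real.norm_eq_abs, abs_of_pos (hWf t ht).1]
    calc W t * ‖f t‖ ≤ 1 * M := mul_le_mul (hWf t ht).2.1 (hf t ht) (norm_nonneg _) zero_le_one
      _ = M := one_mul M
  have hgain : ∀ t ∈ Icc a b, β₀ ≤ -(αv t).re
      - (‖β‖ / (2 * G)) / (1 - ‖β‖ / (2 * G)) * (2 * |(αv t).im| + ‖β‖ / (2 * G) * ‖β‖)
      - (w t * ‖(0 : ℂ)‖ / (2 * G)) / (1 - ‖β‖ / (2 * G)) := by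
    intro t ht
    have htc : 0 < t - c := by linarith [ht.1]
    have hre : (αv t).re = α.re - p * w t / (t - c) := by simp only [hαv, Complex.sub_re, Complex.ofReal_re]
    have him : (αv t).im = α.im := by simp only [hαv, Complex.sub_im, Complex.ofReal_im, sub_zero]
    rw [hre, him, norm_zero, mul_zero, zero_div, zero_div, sub_zero]
    have h3 : p * w₁ ≤ p * w t / (t - c) := by
      rw [le_div_iff₀ htc]; nlinarith [hw t ht, hp0]
    linarith
  have hWa : W a = 1 := by simp only [hW]; rw [div_self hac.ne', Real.one_rpow]
  have hva : ‖v a‖ ≤ M / β₀ := by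
    simp only [hvdef, hudef]; rw [hWa, norm_mul, norm_mul, hph, Complex.ofReal_one, norm_one, one_mul, one_mul]; exact ha
  have hfence := farBranch_norm_le_of_damped_var (β := fun _ => β) (β' := fun _ => 0) (βmax := ‖β‖) hG hM hβ₀ (norm_nonneg β) hvder hθ
    (fun t _ => hasDerivAt_const t β) hwpos hwθ hodev hg (fun t _ => le_rfl) hsmall hgain hva
  intro τ hτ
  have hWτ := (hWf τ hτ).1
  have hρpos : 0 < (τ - c) / (a - c) := div_pos (by linarith [hτ.1]) hac
  have hzτ : ‖z τ‖ = ((τ - c) / (a - c)) ^ p * ‖v τ‖ := by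
    simp only [hvdef, hudef]
    rw [norm_mul, norm_mul, hph, one_mul, Complex.norm_real, Real.norm_eq_abs, abs_of_pos hWτ, ← mul_assoc, hW,
      ← Real.rpow_add hρpos, add_neg_cancel, Real.rpow_zero, one_mul]
  rw [hzτ]
  exact mul_le_mul_of_nonneg_left (hfence τ hτ) (Real.rpow_nonneg hρpos.le _)

/-! ## §3 The left side of the waist (reflection `τ ↦ 2c − τ`) -/

/-- **Left twin of `farBranch_norm_le_weighted`.**  On `[b, a]` with `a < c` and `−w τ ≥ w₁(c − τ)` (the amplified zone to the LEFT of the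
waist, integrated outward = towards decreasing `τ`), the same hypotheses with `‖z a‖ ≤ M/β₀` give
`‖z τ‖ ≤ ((c−τ)/(c−a))^p·((1+k)M/β₀)/(1−k)` on `[b, a]` (reflection `s ↦ 2c − s`). [folklore] -/
theorem farBranch_norm_le_weighted_left {z z' f : ℝ → ℂ} {w : ℝ → ℝ} {a b c G M β₀ w₁ p : ℝ} {α β : ℂ}
    (hG : 0 < G) (hM : 0 ≤ M) (hβ₀ : 0 < β₀) (hac : a < c) (hw₁ : 0 < w₁)
    (hp : p * w₁ = α.re + β₀ + (‖β‖ / (2 * G)) / (1 - ‖β‖ / (2 * G)) * (2 * |α.im| + ‖β‖ / (2 * G) * ‖β‖)) (hp0 : 0 ≤ p)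
    (hz : ∀ τ ∈ Icc b a, HasDerivAt z (z' τ) τ) (hwcont : Continuous w) (hw : ∀ τ ∈ Icc b a, w₁ * (c - τ) ≤ -w τ)
    (hode : ∀ τ ∈ Icc b a, (w τ : ℂ) * z' τ = I * G * z τ + α * z τ + β * conj (z τ) + f τ)
    (hf : ∀ τ ∈ Icc b a, ‖f τ‖ ≤ M) (hsmall : ‖β‖ ≤ G) (ha : ‖z a‖ ≤ M / β₀) :
    ∀ τ ∈ Icc b a, ‖z τ‖ ≤ ((c - τ) / (c - a)) ^ p * (((1 + ‖β‖ / (2 * G)) * M / β₀) / (1 - ‖β‖ / (2 * G))) := by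
  intro τ hτ
  have hmem : ∀ s ∈ Icc (2 * c - a) (2 * c - b), 2 * c - s ∈ Icc b a := fun s hs => ⟨by linarith [hs.2], by linarith [hs.1]⟩
  have hzr : ∀ s ∈ Icc (2 * c - a) (2 * c - b), HasDerivAt (fun r => z (2 * c - r)) (-z' (2 * c - s)) s := by
    intro s hs
    have h1 : HasDerivAt (fun r : ℝ => 2 * c - r) (-1) s := by
      simpa using (hasDerivAt_id s).const_sub (2 * c)
    have h := (hz (2 * c - s) (hmem s hs)).scomp s h1
    simpa [Function.comp_def] using h
  have hwr : Continuous fun r => -w (2 * c - r) := (hwcont.comp (continuous_const.sub continuous_id)).neg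
  have hwrge : ∀ s ∈ Icc (2 * c - a) (2 * c - b), w₁ * (s - c) ≤ -w (2 * c - s) := by
    intro s hs
    have := hw (2 * c - s) (hmem s hs)
    linarith
  have hoder : ∀ s ∈ Icc (2 * c - a) (2 * c - b), ((-w (2 * c - s) : ℝ) : ℂ) * (-z' (2 * c - s))
      = I * G * z (2 * c - s) + α * z (2 * c - s) + β * conj (z (2 * c - s)) + f (2 * c - s) := by
    intro s hs
    rw [← hode (2 * c - s) (hmem s hs)]; push_cast; ring
  have hfr : ∀ s ∈ Icc (2 * c - a) (2 * c - b), ‖f (2 * c - s)‖ ≤ M := fun s hs => hf _ (hmem s hs)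
  have har : ‖z (2 * c - (2 * c - a))‖ ≤ M / β₀ := by rw [show 2 * c - (2 * c - a) = a by ring]; exact ha
  have h := farBranch_norm_le_weighted (z := fun r => z (2 * c - r)) (a := 2 * c - a) (b := 2 * c - b) (c := c) hG hM hβ₀
    (by linarith) hw₁ hp hp0 hzr hwr hwrge hoder hfr hsmall har (2 * c - τ) ⟨by linarith [hτ.2], by linarith [hτ.1]⟩
  have e1 : 2 * c - (2 * c - τ) = τ := by ring
  have e2 : (2 * c - τ - c) / (2 * c - a - c) = (c - τ) / (c - a) := by
    rw [show 2 * c - τ - c = c - τ by ring, show 2 * c - a - c = c - a by ring]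
  rw [e1, e2] at h
  exact h

end Summit.NavierStokesRegularity.NavierStokesRegularity.Theorems.Clause13Transport
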